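import Literature.MathematicalPhysics.QuantumFieldTheory.Balaban1983to89.Beta.KernelWard

/-!
# `BalabanUV.Beta.D1BFx.KernelWardInsertion` — road «BF-x» for binder row D1, slot (K), census groups G_Λ ∕ NEEDLES, FINDING F-g9-1 brick **«LG-TRACE-Z4, LOCAL
# FORM»**: an2's Ward identity `KernelWard.ward_hess` (first-bond transversality of the resolvent Hessian from the covariance laws (W1)∕(W2)) GENERALISED TO AN
# INDEPENDENT INSERTION — the RESPONSE of the insertion tadpole `½·tr[A·Y]` to the background, `resp_μ(y) := ½·tadpole A (Z μ y) − ½·bubble A (V μ y) Y`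
# (`Z` = the insertion's first-order jets, `V` = the operator's), is TRANSVERSAL: `Σ_μ (resp_μ(y − e_μ) − resp_μ(y)) = 0`, given (W1) for `V` and the insertion's
# covariance letter (W2′) `divV Z y = X y ∘ Y − Y ∘ X y`

HONEST DEPENDENCY (cell records, verbatim): «continuum YM on T⁴ ⇐ BetaPertH ∧ nine spine estimates (0/9 proved); BetaPertH ⇐ (D1) ∧ (D4) ∧
CAP+tail; G-an2-4 gates asym, D1 and NE2/3/4.»  HONEST FRAMING (cell contract, verbatim): «discharging `BetaPertH` makes Bałaban's UV stability
UNCONDITIONAL — a real constructive-QFT result; it is NOT the continuum limit and NOT the Clay problem.»  THIS MODULE DISCHARGES NOTHING of (K),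
of D1 or of the wall: [folklore] kernel calculus over ABSTRACT data, by the bricks of `KernelWard` §1–§5 BY NAME (the proof is `ward_hess`'s with the second
slot frozen to the insertion).  No definition, no `def … : Prop`, nothing cited, no wall binder instantiated, 0 sorry.  (W1) for Bałaban's typed operator
and (W2′) for the typed insertion (`hessFF`) are NOT proved here — they are the row's letter content (K-chain).  NOT D1, NOT BetaPertH, NOT continuum, NOT Clay.

ABSOLUTE RULE (cell charter, verbatim): «No internally-minted statement may enter as a cited fact. Every hypothesis is either kernel-proved in this
package or a verbatim quotation of a PUBLISHED theorem with page reference. The manuscript(s) under audit are NOT citable for their own disputed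
steps — they are the thing under adjudication; programme-internal (2001/route/tribunal) claims are never citable.»

WHERE THIS SITS (`HOME/b2b-balaban-beta-d1-p2/K-CLOSURE-PLAN-R1L.md` §6, FINDING F-g9-1; MODEL = `D1BFx/LinearGaugeTrace`): letter (III) of the G_Λ row
(`Σ_X N̄_X + seagull = 0`) is the ZERO-MOMENTUM moment of THIS local law for the insertion `Y := Q̃″_b`; the zero-momentum form follows by summation by parts
(`PolarizationSign.tsum_eq_zero_of_ward` pattern) — not here.  Unit `b2b-balaban-beta-d1-p2` (road owner, gen 9).
-/

open Finset
open scoped BigOperators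
open Literature.MathematicalPhysics.QuantumFieldTheory.Balaban1983to89
open Literature.MathematicalPhysics.QuantumFieldTheory.Balaban1983to89.Beta
open B12Sec2to5 (l1 l1_nonneg)
open B6BondElimination (unitVec unitVec_apply)
open ExpKernelCalculus (Decays BiLoc comp tr bubble tadpole VertexFamily Zl summable_exp_shift' tsum_exp_shift' biLoc_comp_decays
  biLoc_comp_biLoc summable_trTerm)
open KernelWard (Bdd bdd_of_decays bdd_of_biLoc biLoc_recentre biLoc_sub biLoc_finset_sum slices_bdd_biLoc slices_biLoc_bdd comp_sub_right
  comp_sub_left tr_sub comp_assoc_dbb comp_assoc_bdb tr_comp_comm_bb bubble_sum_sub_left tadpole_sum_sub divV)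

namespace Summit.QuantumFields.BalabanUV.Beta.D1BFx.KernelWardInsertion

noncomputable section

variable {D : ℕ} {F : Type*} [Fintype F]

/-- [folklore] **THE WARD IDENTITY FOR THE RESPONSE OF AN INSERTION TADPOLE.**  Let `A` decay, `V` be a first-order vertex family localised at the coarse
bonds (scale `N`), `X y` the gauge generator at the coarse site `y` (bi-localised at `N•y`), `Y` an INSERTION bi-localised at a site `Q`, and `Z μ y` its
first-order jets (bi-localised at `(N•y, Q)`).  If
(W1) `(A ∘ divV V y) ∘ A = A ∘ X y − X y ∘ A` (the operator's covariance: pure-gauge first-order vertex = commutator with the generator), and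
(W2′) `divV Z y = X y ∘ Y − Y ∘ X y` (the insertion's covariance: the pure-gauge slice of its jet is the generator's action on it),
then `Σ_μ ((½·tadpole A (Z μ (y − e_μ)) − ½·bubble A (V μ (y − e_μ)) Y) − (½·tadpole A (Z μ y) − ½·bubble A (V μ y) Y)) = 0`.
Proof: `KernelWard.ward_hess`'s — `½·tr(A[X,Y]) − ½·tr([A,X]Y) = 0` made honest by the §1–§5 bricks. -/
theorem ward_insertion {A : ExpKernelCalculus.MKer D F} {V Z : Fin D → (Fin D → ℤ) → ExpKernelCalculus.MKer D F}
    {Y : ExpKernelCalculus.MKer D F} {C Cv Cz Cy Cx δ : ℝ} {N : ℕ} {Q : Fin D → ℤ}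
    (X : (Fin D → ℤ) → ExpKernelCalculus.MKer D F)
    (hA : Decays A C δ) (hV : VertexFamily V N Cv δ) (hZ : ∀ μ y, BiLoc (Z μ y) ((N : ℤ) • y) Q Cz δ) (hY : BiLoc Y Q Q Cy δ)
    (hX : ∀ y, BiLoc (X y) ((N : ℤ) • y) ((N : ℤ) • y) Cx δ) (hδ : 0 < δ)
    (hW1 : ∀ y, comp (comp A (divV V y)) A = comp A (X y) - comp (X y) A)
    (hW2 : ∀ y, divV Z y = comp (X y) Y - comp Y (X y))
    (y : Fin D → ℤ) :
    ∑ μ, (((1 / 2 : ℝ) * tadpole A (Z μ (y - unitVec μ)) - (1 / 2) * bubble A (V μ (y - unitVec μ)) Y)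
      - ((1 / 2) * tadpole A (Z μ y) - (1 / 2) * bubble A (V μ y) Y)) = 0 := by
  have hδ2 : 0 < δ / 2 := by linarith
  have hAb : Bdd A C := bdd_of_decays hA hδ.le
  set P : Fin D → ℤ := (N : ℤ) • y with hPdef
  have hV₁ : ∀ μ ∈ (Finset.univ : Finset (Fin D)), BiLoc (V μ (y - unitVec μ)) P P
      (Cv * Real.exp (δ * (l1 ((N : ℤ) • (y - unitVec μ) - P) + l1 ((N : ℤ) • (y - unitVec μ) - P)))) δ :=
    fun μ _ => biLoc_recentre (hV μ (y - unitVec μ)) hδ.le P P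
  have hV₂ : ∀ μ ∈ (Finset.univ : Finset (Fin D)), BiLoc (V μ y) P P (Cv * Real.exp (δ * (l1 (P - P) + l1 (P - P)))) δ :=
    fun μ _ => biLoc_recentre (hV μ y) hδ.le P P
  have hZ₁ : ∀ μ ∈ (Finset.univ : Finset (Fin D)), BiLoc (Z μ (y - unitVec μ)) P Q
      (Cz * Real.exp (δ * (l1 ((N : ℤ) • (y - unitVec μ) - P) + l1 (Q - Q)))) δ :=
    fun μ _ => biLoc_recentre (hZ μ (y - unitVec μ)) hδ.le P Q
  have hZ₂ : ∀ μ ∈ (Finset.univ : Finset (Fin D)), BiLoc (Z μ y) P Q (Cz * Real.exp (δ * (l1 (P - P) + l1 (Q - Q)))) δ :=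
    fun μ _ => biLoc_recentre (hZ μ y) hδ.le P Q
  have hXy : BiLoc (X y) P P Cx δ := hX y
  -- step 1: the divergence of `resp` is `½ tadpole A (divV Z y) − ½ bubble A (divV V y) Y`
  have e1 : ∑ μ, (((1 / 2 : ℝ) * tadpole A (Z μ (y - unitVec μ)) - (1 / 2) * bubble A (V μ (y - unitVec μ)) Y)
        - ((1 / 2) * tadpole A (Z μ y) - (1 / 2) * bubble A (V μ y) Y))
      = (1 / 2) * tadpole A (divV Z y) - (1 / 2) * bubble A (divV V y) Y := by
    unfold divV
    rw [tadpole_sum_sub Finset.univ hA hZ₁ hZ₂ hδ, bubble_sum_sub_left Finset.univ hA hV₁ hV₂ hY hδ, Finset.mul_sum,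
      Finset.mul_sum, ← Finset.sum_sub_distrib]
    refine Finset.sum_congr rfl fun μ _ => ?_
    ring
  -- localisation of `divV V y`
  have hD : BiLoc (divV V y) P P _ δ := biLoc_finset_sum Finset.univ fun μ hμ => biLoc_sub (hV₁ μ hμ) (hV₂ μ hμ)
  have hAD := biLoc_comp_decays hA hD (show 0 ≤ δ / 2 by linarith) (show δ / 2 < δ by linarith)
  have hAX := biLoc_comp_decays hA hXy (show 0 ≤ δ / 2 by linarith) (show δ / 2 < δ by linarith)
  have hAY := biLoc_comp_decays hA hY (show 0 ≤ δ / 2 by linarith) (show δ / 2 < δ by linarith)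
  have hXY := biLoc_comp_biLoc hXy hY hδ
  have hYX := biLoc_comp_biLoc hY hXy hδ
  have hY2 : BiLoc Y Q Q Cy (δ / 2) := fun x z a b => (hY x z a b).trans (by
    have hc : 0 ≤ Cy := hY.nonneg a
    refine mul_le_mul_of_nonneg_left (Real.exp_le_exp.mpr ?_) hc
    nlinarith [l1_nonneg (x - Q), l1_nonneg (z - Q), hδ.le])
  have hXy2 : BiLoc (X y) P P Cx (δ / 2) := fun x z a b => (hXy x z a b).trans (by
    have hc : 0 ≤ Cx := hXy.nonneg a
    refine mul_le_mul_of_nonneg_left (Real.exp_le_exp.mpr ?_) hc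
    nlinarith [l1_nonneg (x - P), l1_nonneg (z - P), hδ.le])
  have hA2 : Decays A C (δ / 2) := fun x z a b => (hA x z a b).trans (by
    have hc : 0 ≤ C := hA.nonneg a
    refine mul_le_mul_of_nonneg_left (Real.exp_le_exp.mpr ?_) hc
    nlinarith [l1_nonneg (x - z), hδ.le])
  -- step 2: the bubble term `tr((A∘divV)∘(A∘Y)) = tr(((A∘divV)∘A)∘Y) = tr((A∘X)∘Y) − tr(X∘(A∘Y))`
  have e2 : bubble A (divV V y) Y = tr (comp (comp A (X y)) Y) - tr (comp (X y) (comp A Y)) := by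
    unfold ExpKernelCalculus.bubble
    rw [comp_assoc_bdb hAD hA2 hY2 hδ2, hW1 y]
    rw [comp_sub_left (slices_biLoc_bdd hAX (bdd_of_biLoc hY hδ.le) hδ2) ?_]
    · rw [← comp_assoc_bdb hXy2 hA2 hY2 hδ2]
      exact tr_sub (summable_trTerm (biLoc_comp_biLoc hAX hY2 hδ2) hδ2)
        (summable_trTerm (biLoc_comp_biLoc hXy2 hAY hδ2) hδ2)
    · intro x z a b
      have hXA : Bdd (comp (X y) A) ((Fintype.card F : ℝ) * (Cx * C) * Zl D δ) := by
        intro u v c e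
        have hc : 0 ≤ Cx := hXy.nonneg c
        have hC : 0 ≤ C := hA.nonneg c
        show |∑' t, ∑ f, X y u t c f * A t v f e| ≤ _
        have hs := summable_exp_shift' hδ P
        have hmaj := hs.mul_left ((Fintype.card F : ℝ) * (Cx * C))
        have hb := tsum_of_norm_bounded hmaj.hasSum (fun t => by
          rw [Real.norm_eq_abs]
          calc |∑ f, X y u t c f * A t v f e| ≤ ∑ f, |X y u t c f * A t v f e| := Finset.abs_sum_le_sum_abs _ _
            _ ≤ ∑ _f : F, Cx * C * Real.exp (-δ * l1 (t - P)) := Finset.sum_le_sum fun f _ => by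
                rw [abs_mul]
                have h1 : |X y u t c f| ≤ Cx * Real.exp (-δ * l1 (t - P)) := by
                  refine (hXy u t c f).trans (mul_le_mul_of_nonneg_left (Real.exp_le_exp.mpr ?_) hc)
                  nlinarith [l1_nonneg (u - P), hδ.le]
                have h2 : |A t v f e| ≤ C := hAb t v f e
                calc |X y u t c f| * |A t v f e| ≤ (Cx * Real.exp (-δ * l1 (t - P))) * C :=
                      mul_le_mul h1 h2 (abs_nonneg _) (by positivity)
                  _ = Cx * C * Real.exp (-δ * l1 (t - P)) := by ring
            _ = (Fintype.card F : ℝ) * (Cx * C) * Real.exp (-δ * l1 (t - P)) := by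
                rw [Finset.sum_const, Finset.card_univ, nsmul_eq_mul]; ring)
        rw [Real.norm_eq_abs] at hb
        refine hb.trans (le_of_eq ?_)
        rw [tsum_mul_left, tsum_exp_shift']
      exact slices_bdd_biLoc hXA hY hδ x z a b
  -- step 3: the tadpole term `tr(A∘(X∘Y − Y∘X)) = tr((A∘X)∘Y) − tr(X∘(A∘Y))`
  have e3 : tadpole A (divV Z y) = tr (comp (comp A (X y)) Y) - tr (comp (X y) (comp A Y)) := by
    unfold ExpKernelCalculus.tadpole
    rw [hW2 y, comp_sub_right (slices_bdd_biLoc hAb hXY hδ) (slices_bdd_biLoc hAb hYX hδ)]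
    rw [tr_sub (summable_trTerm (biLoc_comp_decays hA hXY (show 0 ≤ δ / 2 by linarith) (show δ / 2 < δ by linarith)) hδ2)
      (summable_trTerm (biLoc_comp_decays hA hYX (show 0 ≤ δ / 2 by linarith) (show δ / 2 < δ by linarith)) hδ2)]
    rw [comp_assoc_dbb hA hXy hY hδ, comp_assoc_dbb hA hY hXy hδ, tr_comp_comm_bb hAY hXy2 hδ2]
  rw [e1, e2, e3]
  ring

end

end Summit.QuantumFields.BalabanUV.Beta.D1BFx.KernelWardInsertion
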